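import Literature.Computability.Cryptography.Indistinguishability
import Literature.Computability.MetaComplexity.HeuristicClassesHeurBPPReductionProofs
import Literature.Computability.Complexity.PolynomialEntropyApproximation

/-!
# PneNP / SzkEntropy — crux `PeaWorstToAvg` (stmt-PneNP-10777): average-case hardness from an
# indistinguishable promise-separated pair (card `dual-mode-compile`, first lemma)

Support file for the crux chain on `PeaWorstToAvg` (`Cruxes/PeaWorstToAvg/Sketch.lean`, Card B
`conclusion_of_dualMode`).  The card's mechanism, proved here over the tree's definitions and in
full generality: if two ensembles `K₀`, `K₁` are supported on the NO resp. YES instances of a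
disjoint promise problem `Q` and are computationally indistinguishable
(`IsCompIndistinguishable`, Goldreich Def. 3.2.2), then every ensemble `D` dominating both up to the
factor `2` — in particular the fair mixture `½ K₀ + ½ K₁` — makes the distributional problem
`(Q.yes, D)` hard for randomized heuristic schemes: `(Q.yes, D) ∉ HeurBPP`
(`not_mem_HeurBPP_of_isCompIndistinguishable`).  A scheme `A(x, 1ⁿ, 1ᵐ)` with few bad inputs under
`D_n` would be a distinguisher: run it on the sample.

The one non-print point is the tree's model of probabilistic machines (`RandAlg`: the coin budget is
an arbitrary polynomially bounded function of the INPUT LENGTH — `O(log n)` bits of advice, cf.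
`SzkEntropyPeaWorstToAvgAdviceLeak.lean`): the distinguisher, on `⟨1ⁿ, s⟩`, must hand the simulated
scheme exactly its own number of coins although it cannot compute the scheme's budget.  As in the
tree's `mem_HeurBPP_of_polyTimeReducible_holds` this is arranged by PADDING THE FAILURE PARAMETER:
the distinguisher runs `A` on `⟨s, 1ⁿ, 1^K⟩` with `K = G(|⟨1ⁿ, s⟩|) − |⟨s, 1ⁿ, 1⁰⟩|` for the fixed
polynomial `G = 2X + 4 + 16 (X+2)²`, so that the simulated instance has length exactly `G(|⟨1ⁿ, s⟩|)`
and the distinguisher's budget is `L ↦ coinLen_A (G L)` (`exists_padded_simulator`); `K` then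
depends on `|s|`, and the bad inputs are controlled by the union bound
`Σ_j 1/K(n, j) ≤ Σ_j 1/(16 (j+1)(j+2)) = 1/16` (`toOuterMeasure_badPadded_le`).  The resulting
advantage is `≥ 9/32 > 1/4` at EVERY `n` (`le_distAdvantage_of_scheme`), contradicting negligibility.

Corollary for the crux (`PEA 3`, disjoint by `PEA_disjoint`): `pea_not_mem_HeurBPP_of_dualMode`.
The samplability half of Card B (the fair mixture of samplable ensembles is samplable) is the
Literature file `Computability/MetaComplexity/SamplableMixtures.lean` (proposed separately); the
assembled Card B lemma follows from the two.

References: O. Goldreich, *Foundations of Cryptography I* (2001), Def. 3.2.2, §3.2.2;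
A. Bogdanov, L. Trevisan, *Average-Case Complexity* (2006), Def. 2.12–2.13, Lemma 3.2 (proof);
C. Peikert, B. Waters, *Lossy trapdoor functions and their applications*, STOC 2008 (dual-mode /
lossy families: indistinguishable injective and lossy modes); Z. Dvir, D. Gutfreund, G. Rothblum,
S. Vadhan, *On approximating the entropy of polynomial mappings*, ICS 2011, pp. 2–3.
-/

namespace Summit.PneNP.PneNP.Theorems

open Literature.Computability.Complexity Literature.Computability.MetaComplexity
open Literature.Computability.Cryptography (IsCompIndistinguishable IsPPT acceptPMF distAdvantage)
open Literature.Computability.Complexity.Brick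
open _root_.Computability Filter
open scoped ENNReal

/-! ### Simulating a heuristic scheme inside a distinguisher: padding the failure parameter -/

/-- **The padded simulator.** For a probabilistic polynomial-time heuristic scheme `A(x, 1ⁿ, 1ᵐ)`
there is a PPT algorithm `B` on words `⟨1ⁿ, s⟩` (the input format of distinguishers) whose output
law on `⟨1ⁿ, s⟩` is EXACTLY that of `A` on `⟨s, 1ⁿ, 1^K⟩` with the padded failure parameter
`K = 2n + 4 + 16 (2n + |s| + 4)² = G(|⟨1ⁿ, s⟩|) − |⟨s, 1ⁿ, 1⁰⟩|`, `G = 2X + 4 + 16 (X+2)²`: `B` runs `A` on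
the padded instance with the same coins and budget `L ↦ coinLen_A (G L)`; the instance map is a
total `FP` string function (bricks `fanoutFn`, `fstF/sndF`, `onesFn`, `Plumb.polyFn`, `Plumb.dropFn`),
lifted to `⟨instance, coins⟩` by `mapFstFn_mem_FP` and composed with the machine of `A`
(`PolyTimeComputable.comp_holds`). [BogdanovTrevisan2006, Lemma 3.2 (proof), padded as in the
tree's `mem_HeurBPP_of_polyTimeReducible_holds`; AroraBarak2009, §1.3] -/
theorem exists_padded_simulator {A : RandAlg (List Bool × ℕ × ℕ) Bool}
    (hA : A.IsPolyTime schemeEnc encodeBool) :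
    ∃ B : RandAlg (List Bool) Bool, IsPPT B encodeBool ∧
      ∀ (n : ℕ) (s : List Bool), B.outputPMF id (boolPair (unaryEncodeNat n) s) =
        A.outputPMF schemeEnc (s, n, 2 * n + 4 + 16 * (2 * n + s.length + 4) ^ 2) := by
  have hlenU : ∀ m : ℕ, (unaryEncodeNat m).length = m := fun m => by
    rw [OracleCompose.unaryEncodeNat_eq_replicate, List.length_replicate]
  set G : Polynomial ℕ := 2 * Polynomial.X + 4 + 16 * (Polynomial.X + 2) ^ 2 with hGdef
  have hG : ∀ L, G.eval L = 2 * L + 4 + 16 * (L + 2) ^ 2 := fun L => by simp [hGdef]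
  -- the padded failure parameter and the instance map
  set padK : List Bool → ℕ := fun w =>
    G.eval w.length - (schemeEnc (sndF w, (fstF w).length, 0)).length with hpadK
  set inst : List Bool → List Bool × ℕ × ℕ := fun w => (sndF w, (fstF w).length, padK w) with hinst
  -- … as a total `FP` string function
  set s0F' : List Bool → List Bool := fanoutFn sndF (fanoutFn (onesFn ∘ fstF) fun _ => []) with hs0F'
  set kF' : List Bool → List Bool := Plumb.dropFn ∘ fanoutFn s0F' (Plumb.polyFn G) with hkF'
  set psiF' : List Bool → List Bool := fanoutFn sndF (fanoutFn (onesFn ∘ fstF) kF') with hpsiF'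
  have hs0 : ∀ w, s0F' w = schemeEnc (sndF w, (fstF w).length, 0) := fun w => by
    simp only [hs0F', fanoutFn_apply, Function.comp_apply, schemeEnc, onesFn]
    rfl
  have hk : ∀ w, kF' w = unaryEncodeNat (padK w) := fun w => by
    rw [hkF', Function.comp_apply, fanoutFn_apply, Plumb.dropFn_boolPair, Plumb.polyFn_apply, hs0 w,
      hpadK, OracleCompose.unaryEncodeNat_eq_replicate, List.drop_replicate]
  have hpsi : ∀ w, psiF' w = schemeEnc (inst w) := fun w => by
    rw [hpsiF', fanoutFn_apply, fanoutFn_apply, Function.comp_apply, hk w]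
    rfl
  have hpsiFP : psiF' ∈ FP := by
    have h0 : s0F' ∈ FP := fanoutFn_mem_FP sndF_mem_FP
      (fanoutFn_mem_FP (comp_mem_FP onesFn_mem_FP fstF_mem_FP) (const_mem_FP []))
    have h1 : kF' ∈ FP := comp_mem_FP Plumb.dropFn_mem_FP (fanoutFn_mem_FP h0 (Plumb.polyFn_mem_FP G))
    exact fanoutFn_mem_FP sndF_mem_FP (fanoutFn_mem_FP (comp_mem_FP onesFn_mem_FP fstF_mem_FP) h1)
  -- the simulator
  set B : RandAlg (List Bool) Bool := ⟨fun w r => A.run (inst w) r, fun L => A.coinLen (G.eval L)⟩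
    with hB
  refine ⟨B, ?_, fun n s => ?_⟩
  · obtain ⟨pA, hpA⟩ := hA.2
    refine ⟨?_, pA.comp G, fun L => by rw [Polynomial.eval_comp]; exact hpA _⟩
    have hmap : PolyTimeComputable (fun p : List Bool × List Bool => boolPair (id p.1) p.2)
        (fun q : (List Bool × ℕ × ℕ) × List Bool => boolPair (schemeEnc q.1) q.2)
        (fun p : List Bool × List Bool => (inst p.1, p.2)) :=
      (mapFstFn_mem_FP hpsiFP).of_comp_encode (fun p : List Bool × List Bool => boolPair p.1 p.2)
        (fun _ => rfl) (fun p => by simp only [id, mapFstFn_boolPair, hpsi])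
    exact PolyTimeComputable.comp_holds hA.1 hmap
  · -- the output law: same run, same number of coins
    have hw : (boolPair (unaryEncodeNat n) s).length = 2 * n + 2 + s.length := by
      rw [length_boolPair, hlenU]
    have hinst_w : inst (boolPair (unaryEncodeNat n) s) =
        (s, n, 2 * n + 4 + 16 * (2 * n + s.length + 4) ^ 2) := by
      simp only [hinst, hpadK, fstF_boolPair, sndF_boolPair, hlenU, hw, hG, length_schemeEnc]
      congr 2
      have h16 : 16 * (2 * n + 2 + s.length + 2) ^ 2 = 16 * (2 * n + s.length + 4) ^ 2 := by ring_nf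
      omega
    have hlenEq : B.coinLen (id (boolPair (unaryEncodeNat n) s)).length =
        A.coinLen (schemeEnc (s, n, 2 * n + 4 + 16 * (2 * n + s.length + 4) ^ 2)).length := by
      simp only [hB, id, hw, hG, length_schemeEnc]
      congr 1
      have h16 : 16 * (2 * n + 2 + s.length + 2) ^ 2 = 16 * (2 * n + s.length + 4) ^ 2 := by ring_nf
      omega
    simp only [RandAlg.outputPMF]
    rw [map_uniformOfFintype_vector_congr hlenEq]
    simp only [hB, hinst_w]

/-! ### Acceptance probabilities: pointwise bounds and their averages -/

/-- A scheme run with coin error `< 1/4` about the target bit `true` accepts with probability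
`≥ 3/4`. [BogdanovTrevisan2006, Def. 2.12] -/
theorem ofReal_le_apply_true_of_error_lt {p : PMF Bool}
    (h : (p.toOuterMeasure {b | b ≠ true}).toReal < 1 / 4) : ENNReal.ofReal (3 / 4) ≤ p true := by
  have hset : {b : Bool | b ≠ true} = {false} := Set.ext fun b => by cases b <;> simp
  rw [hset, PMF.toOuterMeasure_apply_singleton] at h
  have hsum : p false + p true = 1 := by
    have := p.tsum_coe
    rwa [tsum_bool] at this
  have hsum' : (p false).toReal + (p true).toReal = 1 := by
    rw [← ENNReal.toReal_add (PMF.apply_ne_top p false) (PMF.apply_ne_top p true), hsum,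
      ENNReal.toReal_one]
  exact ENNReal.ofReal_le_of_le_toReal (by linarith)

/-- A scheme run with coin error `< 1/4` about the target bit `false` accepts with probability
`≤ 1/4`. [BogdanovTrevisan2006, Def. 2.12] -/
theorem apply_true_le_ofReal_of_error_lt {p : PMF Bool}
    (h : (p.toOuterMeasure {b | b ≠ false}).toReal < 1 / 4) : p true ≤ ENNReal.ofReal (1 / 4) := by
  have hset : {b : Bool | b ≠ false} = {true} := Set.ext fun b => by cases b <;> simp
  rw [hset, PMF.toOuterMeasure_apply_singleton] at h
  exact (ENNReal.le_ofReal_iff_toReal_le (PMF.apply_ne_top p true) (by norm_num)).2 h.le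

/-- **Averaging a lower bound off a bad set**: if `c ≤ f s` for every `s` of the support outside
`S`, then `c · p(Sᶜ) ≤ Σ_s p(s) f(s)`. [folklore] -/
theorem mul_toOuterMeasure_compl_le_tsum (p : PMF (List Bool)) (f : List Bool → ℝ≥0∞)
    (S : Set (List Bool)) (c : ℝ≥0∞) (h : ∀ s ∈ p.support, s ∉ S → c ≤ f s) :
    c * p.toOuterMeasure Sᶜ ≤ ∑' s, p s * f s := by
  rw [PMF.toOuterMeasure_apply, ← ENNReal.tsum_mul_left]
  refine ENNReal.tsum_le_tsum fun s => ?_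
  by_cases hs : s ∈ Sᶜ
  · rw [Set.indicator_of_mem hs, mul_comm]
    by_cases hp : p s = 0
    · simp [hp]
    · gcongr
      exact h s ((PMF.mem_support_iff p s).2 hp) hs
  · simp [Set.indicator_of_notMem hs]

/-- **Averaging an upper bound off a bad set**: if `f ≤ 1` everywhere and `f s ≤ c` for every `s`
of the support outside `S`, then `Σ_s p(s) f(s) ≤ p(S) + c`. [folklore] -/
theorem tsum_mul_le_toOuterMeasure_add (p : PMF (List Bool)) (f : List Bool → ℝ≥0∞)
    (S : Set (List Bool)) (c : ℝ≥0∞) (hf : ∀ s, f s ≤ 1)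
    (h : ∀ s ∈ p.support, s ∉ S → f s ≤ c) : ∑' s, p s * f s ≤ p.toOuterMeasure S + c := by
  have hpt : ∀ s, p s * f s ≤ S.indicator p s + p s * c := by
    intro s
    by_cases hs : s ∈ S
    · rw [Set.indicator_of_mem hs]
      calc p s * f s ≤ p s * 1 := by gcongr; exact hf s
        _ ≤ p s + p s * c := by rw [mul_one]; exact le_self_add
    · rw [Set.indicator_of_notMem hs, zero_add]
      by_cases hp : p s = 0
      · simp [hp]
      · gcongr
        exact h s ((PMF.mem_support_iff p s).2 hp) hs
  calc ∑' s, p s * f s ≤ ∑' s, (S.indicator p s + p s * c) := ENNReal.tsum_le_tsum hpt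
    _ = p.toOuterMeasure S + (∑' s, p s) * c := by
        rw [ENNReal.tsum_add, PMF.toOuterMeasure_apply, ENNReal.tsum_mul_right]
    _ = p.toOuterMeasure S + c := by rw [PMF.tsum_coe, one_mul]

/-- A probability measure charges a set or its complement: `1 ≤ p(Sᶜ) + p(S)`. [folklore] -/
theorem one_le_toOuterMeasure_compl_add (p : PMF (List Bool)) (S : Set (List Bool)) :
    1 ≤ p.toOuterMeasure Sᶜ + p.toOuterMeasure S := by
  have h1 : p.toOuterMeasure Set.univ = 1 :=
    (PMF.toOuterMeasure_apply_eq_one_iff p Set.univ).2 (Set.subset_univ _)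
  rw [← h1, ← Set.compl_union_self S]
  exact MeasureTheory.measure_union_le _ _

/-! ### The bad inputs of the padded simulation: a union bound over the sample length -/

/-- **Few bad inputs at the padded parameters.** If the scheme `A` has, at every `(n, m)`, `m > 0`,
a bad set `B(n, m) = {x | Pr_coins[A(x, 1ⁿ, 1ᵐ) ≠ L(x)] ≥ 1/4}` of `D_n`-mass `≤ 1/m`, then the inputs
that are bad AT THEIR OWN padded parameter `K(n, |x|) = 2n + 4 + 16 (2n + |x| + 4)²` have `D_n`-mass
`≤ 1/16`: they lie in `⋃_j {x : |x| = j} ∩ B(n, K(n, j))`, and `Σ_j 1/K(n, j) ≤ Σ_j 1/(16 (j+1)(j+2)) = 1/16`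
(`tsum_inv_mul_succ_le`). [BogdanovTrevisan2006, Lemma 3.2 (proof: the bad set transfers)] -/
theorem toOuterMeasure_badPadded_le {A : RandAlg (List Bool × ℕ × ℕ) Bool} {L : Set (List Bool)}
    {D : Ensemble}
    (hbad : ∀ n m : ℕ, 0 < m →
      D.prob n {x | 1 / 4 ≤ A.pr schemeEnc (x, n, m) {b | b ≠ L.boolIndicator x}} ≤ 1 / m)
    (n : ℕ) :
    (D n).toOuterMeasure {x | 1 / 4 ≤ A.pr schemeEnc (x, n, 2 * n + 4 + 16 * (2 * n + x.length + 4) ^ 2)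
      {b | b ≠ L.boolIndicator x}} ≤ (16 : ℝ≥0∞)⁻¹ := by
  set κ : ℕ → ℕ := fun j => 2 * n + 4 + 16 * (2 * n + j + 4) ^ 2 with hκ
  set Bad : ℕ → Set (List Bool) := fun m =>
    {x | 1 / 4 ≤ A.pr schemeEnc (x, n, m) {b | b ≠ L.boolIndicator x}} with hBad
  have hcover : {x : List Bool | 1 / 4 ≤ A.pr schemeEnc (x, n, 2 * n + 4 + 16 * (2 * n + x.length + 4) ^ 2)
      {b | b ≠ L.boolIndicator x}} ⊆ ⋃ j, {x | x.length = j ∧ x ∈ Bad (κ j)} := by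
    intro x hx
    simp only [Set.mem_iUnion]
    exact ⟨x.length, rfl, hx⟩
  have hκ16 : ∀ j, 16 * ((j + 0 + 1) * (j + 0 + 2)) ≤ κ j := fun j => by
    simp only [hκ]; nlinarith
  have hpiece : ∀ j, (D n).toOuterMeasure {x | x.length = j ∧ x ∈ Bad (κ j)} ≤
      (16 : ℝ≥0∞)⁻¹ * ((((j + 0 + 1) * (j + 0 + 2) : ℕ)) : ℝ≥0∞)⁻¹ := by
    intro j
    have hκpos : 0 < κ j := by simp only [hκ]; omega
    calc (D n).toOuterMeasure {x | x.length = j ∧ x ∈ Bad (κ j)}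
        ≤ (D n).toOuterMeasure (Bad (κ j)) := (D n).toOuterMeasure.mono fun x hx => hx.2
      _ ≤ ((κ j : ℕ) : ℝ≥0∞)⁻¹ := toOuterMeasure_le_inv_of_prob_le hκpos (hbad n (κ j) hκpos)
      _ ≤ (((16 * ((j + 0 + 1) * (j + 0 + 2)) : ℕ)) : ℝ≥0∞)⁻¹ :=
          ENNReal.inv_le_inv.2 (by exact_mod_cast hκ16 j)
      _ = (16 : ℝ≥0∞)⁻¹ * ((((j + 0 + 1) * (j + 0 + 2) : ℕ)) : ℝ≥0∞)⁻¹ := by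
          rw [Nat.cast_mul, ENNReal.mul_inv (Or.inl (by norm_num)) (Or.inl (by norm_num))]
          norm_num
  calc (D n).toOuterMeasure _
      ≤ (D n).toOuterMeasure (⋃ j, {x | x.length = j ∧ x ∈ Bad (κ j)}) := (D n).toOuterMeasure.mono hcover
    _ ≤ ∑' j, (D n).toOuterMeasure {x | x.length = j ∧ x ∈ Bad (κ j)} := MeasureTheory.measure_iUnion_le _
    _ ≤ ∑' j : ℕ, (16 : ℝ≥0∞)⁻¹ * ((((j + 0 + 1) * (j + 0 + 2) : ℕ)) : ℝ≥0∞)⁻¹ :=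
        ENNReal.tsum_le_tsum hpiece
    _ = (16 : ℝ≥0∞)⁻¹ * ∑' j : ℕ, ((((j + 0 + 1) * (j + 0 + 2) : ℕ)) : ℝ≥0∞)⁻¹ := ENNReal.tsum_mul_left
    _ ≤ (16 : ℝ≥0∞)⁻¹ * 1 := by
        gcongr
        simpa using tsum_inv_mul_succ_le 0
    _ = (16 : ℝ≥0∞)⁻¹ := mul_one _

/-! ### The distinguisher has constant advantage -/

/-- **Constant advantage at every `n`.** Let `K₀` be supported on NO instances and `K₁` on YES
instances of a disjoint promise problem `Q`, let `D` dominate both up to the factor `2`, let the scheme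
`A` have bad sets of `D_n`-mass `≤ 1/m` at every `(n, m)`, and let `B` simulate `A` at the padded
parameters (`exists_padded_simulator`).  Then `B` tells `K₀,ₙ` from `K₁,ₙ` with advantage `≥ 9/32`:
outside the bad set (of `K_b,ₙ`-mass `≤ 2/16`, `toOuterMeasure_badPadded_le`) a YES sample is
accepted with probability `≥ 3/4` and a NO sample with probability `≤ 1/4`, so
`Pr[B(K₁,ₙ) = 1] ≥ ¾ (1 − ⅛)` and `Pr[B(K₀,ₙ) = 1] ≤ ⅛ + ¼`. [Goldreich2001, Def. 3.2.2;
BogdanovTrevisan2006, Def. 2.12–2.13] -/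
theorem le_distAdvantage_of_scheme {Q : PromiseProblem} (hQ : Q.Disjoint) {K₀ K₁ D : Ensemble}
    (h₀ : ∀ n : ℕ, ∀ w ∈ (K₀ n).support, w ∈ Q.no) (h₁ : ∀ n : ℕ, ∀ w ∈ (K₁ n).support, w ∈ Q.yes)
    (hD₀ : ∀ (n : ℕ) (E : Set (List Bool)), (K₀ n).toOuterMeasure E ≤ 2 * (D n).toOuterMeasure E)
    (hD₁ : ∀ (n : ℕ) (E : Set (List Bool)), (K₁ n).toOuterMeasure E ≤ 2 * (D n).toOuterMeasure E)
    {A : RandAlg (List Bool × ℕ × ℕ) Bool}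
    (hbad : ∀ n m : ℕ, 0 < m →
      D.prob n {x | 1 / 4 ≤ A.pr schemeEnc (x, n, m) {b | b ≠ Q.yes.boolIndicator x}} ≤ 1 / m)
    {B : RandAlg (List Bool) Bool}
    (hB : ∀ (n : ℕ) (s : List Bool), B.outputPMF id (boolPair (unaryEncodeNat n) s) =
      A.outputPMF schemeEnc (s, n, 2 * n + 4 + 16 * (2 * n + s.length + 4) ^ 2))
    (n : ℕ) : (9 : ℝ) / 32 ≤ distAdvantage B K₀ K₁ n := by
  -- notation
  set κ : List Bool → ℕ := fun s => 2 * n + 4 + 16 * (2 * n + s.length + 4) ^ 2 with hκ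
  set q : List Bool → PMF Bool := fun s => A.outputPMF schemeEnc (s, n, κ s) with hq
  set bad : Set (List Bool) :=
    {x | 1 / 4 ≤ A.pr schemeEnc (x, n, κ x) {b | b ≠ Q.yes.boolIndicator x}} with hbadS
  -- acceptance probabilities as sums over the sample
  have hacc : ∀ K : Ensemble, acceptPMF B n (K n) true = ∑' s, K n s * q s true := fun K => by
    rw [acceptPMF, PMF.bind_apply]
    exact tsum_congr fun s => by rw [hB]
  -- pointwise bounds outside the bad set
  have hyes : ∀ s ∈ (K₁ n).support, s ∉ bad → ENNReal.ofReal (3 / 4) ≤ q s true := by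
    intro s hs hnb
    have hind : Q.yes.boolIndicator s = true := (Set.mem_iff_boolIndicator _ _).1 (h₁ n s hs)
    have hlt : A.pr schemeEnc (s, n, κ s) {b | b ≠ true} < 1 / 4 := by
      rw [← hind]; exact not_le.1 hnb
    exact ofReal_le_apply_true_of_error_lt hlt
  have hno : ∀ s ∈ (K₀ n).support, s ∉ bad → q s true ≤ ENNReal.ofReal (1 / 4) := by
    intro s hs hnb
    have hnot : s ∉ Q.yes := fun h => Set.disjoint_left.1 hQ h (h₀ n s hs)
    have hind : Q.yes.boolIndicator s = false :=
      Bool.eq_false_iff.2 (mt (Set.mem_iff_boolIndicator _ _).2 hnot)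
    have hlt : A.pr schemeEnc (s, n, κ s) {b | b ≠ false} < 1 / 4 := by
      rw [← hind]; exact not_le.1 hnb
    exact apply_true_le_ofReal_of_error_lt hlt
  -- the averaged bounds, in `ℝ≥0∞`
  have I1 : ENNReal.ofReal (3 / 4) * (K₁ n).toOuterMeasure badᶜ ≤ acceptPMF B n (K₁ n) true := by
    rw [hacc]
    exact mul_toOuterMeasure_compl_le_tsum _ _ _ _ hyes
  have I0 : acceptPMF B n (K₀ n) true ≤ (K₀ n).toOuterMeasure bad + ENNReal.ofReal (1 / 4) := by
    rw [hacc]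
    exact tsum_mul_le_toOuterMeasure_add _ _ _ _ (fun s => PMF.coe_le_one _ _) hno
  have Ibad : (D n).toOuterMeasure bad ≤ (16 : ℝ≥0∞)⁻¹ := toOuterMeasure_badPadded_le hbad n
  have Ib0 : (K₀ n).toOuterMeasure bad ≤ 2 * (16 : ℝ≥0∞)⁻¹ := (hD₀ n bad).trans (by gcongr)
  have Ib1 : (K₁ n).toOuterMeasure bad ≤ 2 * (16 : ℝ≥0∞)⁻¹ := (hD₁ n bad).trans (by gcongr)
  have Ic : 1 ≤ (K₁ n).toOuterMeasure badᶜ + (K₁ n).toOuterMeasure bad :=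
    one_le_toOuterMeasure_compl_add _ _
  -- … transported to `ℝ`
  have htop : ∀ (p : PMF (List Bool)) (E : Set (List Bool)), p.toOuterMeasure E ≠ ∞ :=
    fun p E => toOuterMeasure_ne_top' p E
  have h216 : ((2 : ℝ≥0∞) * 16⁻¹).toReal = 1 / 8 := by
    rw [ENNReal.toReal_mul, ENNReal.toReal_inv]; norm_num
  have r1 : 3 / 4 * ((K₁ n).toOuterMeasure badᶜ).toReal ≤ (acceptPMF B n (K₁ n) true).toReal := by
    have := ENNReal.toReal_mono (PMF.apply_ne_top _ _) I1
    rwa [ENNReal.toReal_mul, ENNReal.toReal_ofReal (by norm_num)] at this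
  have r0 : (acceptPMF B n (K₀ n) true).toReal ≤ ((K₀ n).toOuterMeasure bad).toReal + 1 / 4 := by
    have := ENNReal.toReal_mono (ENNReal.add_ne_top.2 ⟨htop _ _, ENNReal.ofReal_ne_top⟩) I0
    rwa [ENNReal.toReal_add (htop _ _) ENNReal.ofReal_ne_top, ENNReal.toReal_ofReal (by norm_num)]
      at this
  have rb0 : ((K₀ n).toOuterMeasure bad).toReal ≤ 1 / 8 := by
    have := ENNReal.toReal_mono (ENNReal.mul_ne_top (by norm_num) (by norm_num)) Ib0
    rwa [h216] at this
  have rb1 : ((K₁ n).toOuterMeasure bad).toReal ≤ 1 / 8 := by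
    have := ENNReal.toReal_mono (ENNReal.mul_ne_top (by norm_num) (by norm_num)) Ib1
    rwa [h216] at this
  have rc : 1 ≤ ((K₁ n).toOuterMeasure badᶜ).toReal + ((K₁ n).toOuterMeasure bad).toReal := by
    have := ENNReal.toReal_mono (ENNReal.add_ne_top.2 ⟨htop _ _, htop _ _⟩) Ic
    rwa [ENNReal.toReal_one, ENNReal.toReal_add (htop _ _) (htop _ _)] at this
  -- conclusion
  rw [distAdvantage, abs_sub_comm]
  refine le_trans ?_ (le_abs_self _)
  linarith

/-- **Average-case hardness from an indistinguishable promise-separated pair** (the mechanism of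
the crux-chain card `dual-mode-compile`).  If `K₀` is supported on the NO instances and `K₁` on the
YES instances of a disjoint promise problem `Q`, and `K₀`, `K₁` are computationally
indistinguishable, then for every ensemble `D` dominating both up to the factor `2` (e.g. the fair
mixture `½ K₀ + ½ K₁`) the distributional problem `(Q.yes, D)` is not in `HeurBPP`: a randomized
heuristic scheme for it, simulated at padded failure parameters (`exists_padded_simulator`), is a PPT
distinguisher with advantage `≥ 9/32` at every `n` (`le_distAdvantage_of_scheme`), which is not
negligible. [Goldreich2001, Def. 3.2.2 and §3.2.2; BogdanovTrevisan2006, Def. 2.12–2.13] -/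
theorem not_mem_HeurBPP_of_isCompIndistinguishable {Q : PromiseProblem} (hQ : Q.Disjoint)
    {K₀ K₁ D : Ensemble}
    (h₀ : ∀ n : ℕ, ∀ w ∈ (K₀ n).support, w ∈ Q.no) (h₁ : ∀ n : ℕ, ∀ w ∈ (K₁ n).support, w ∈ Q.yes)
    (hD₀ : ∀ (n : ℕ) (E : Set (List Bool)), (K₀ n).toOuterMeasure E ≤ 2 * (D n).toOuterMeasure E)
    (hD₁ : ∀ (n : ℕ) (E : Set (List Bool)), (K₁ n).toOuterMeasure E ≤ 2 * (D n).toOuterMeasure E)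
    (hind : IsCompIndistinguishable K₀ K₁) :
    (⟨Q.yes, D⟩ : DistProblem) ∉ HeurBPP := by
  rintro ⟨A, hA, hbad⟩
  obtain ⟨B, hB, hout⟩ := exists_padded_simulator hA
  have hneg := hind B hB 0
  have hev := hneg.eventually (gt_mem_nhds (show (0 : ℝ) < 9 / 32 by norm_num))
  obtain ⟨n, hn⟩ := hev.exists
  simp only [pow_zero, one_mul] at hn
  exact absurd (le_distAdvantage_of_scheme hQ h₀ h₁ hD₀ hD₁ hbad hout n) (not_le.2 hn)

/-- **The same for the crux's problem `PEA d`** (disjoint promise, `PEA_disjoint`): an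
indistinguishable pair of ensembles of degree-`d` entropy-approximation instances, one supported on
NO instances (`H ≤ k`) and one on YES instances (`H ≥ k + 1`), makes `((PEA d).yes, D) ∉ HeurBPP` for
every ensemble `D` dominating both up to the factor `2` — in particular for their fair mixture, the
hard ensemble of Card B of the crux chain on `PeaWorstToAvg`.
[DvirGutfreundRothblumVadhan2010, pp. 2–3; Goldreich2001, Def. 3.2.2] -/
theorem pea_not_mem_HeurBPP_of_dualMode (d : ℕ) {K₀ K₁ D : Ensemble}
    (h₀ : ∀ n : ℕ, ∀ w ∈ (K₀ n).support, w ∈ (PEA d).no)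
    (h₁ : ∀ n : ℕ, ∀ w ∈ (K₁ n).support, w ∈ (PEA d).yes)
    (hD₀ : ∀ (n : ℕ) (E : Set (List Bool)), (K₀ n).toOuterMeasure E ≤ 2 * (D n).toOuterMeasure E)
    (hD₁ : ∀ (n : ℕ) (E : Set (List Bool)), (K₁ n).toOuterMeasure E ≤ 2 * (D n).toOuterMeasure E)
    (hind : IsCompIndistinguishable K₀ K₁) :
    (⟨(PEA d).yes, D⟩ : DistProblem) ∉ HeurBPP :=
  not_mem_HeurBPP_of_isCompIndistinguishable (PEA_disjoint d) h₀ h₁ hD₀ hD₁ hind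

end Summit.PneNP.PneNP.Theorems
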